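import Summits.CriticalPhenomena.PercolationContinuityZ3.Theorems.PercNearOneGluingNoHeavyQuantLowToZeroRouting
import HarnessLib

/-!
# QUANT lane R8, T-DEC, leg (III): the low-to-zero move from a flow datum in INCOME form — nonzero lows keep their mid pairs,
# their giant-bound masses ride the giants, and ONE aggregated inequality (position-weighted giant-bound mass ≤ low-mid income +
# giant slack) finishes (typer g28, part 5b)

builds on p205010 (kernel theorem, internal audit signed; external expert review pending)

Support file (`--supports stmt-CriticalPhenomena-4575`), QUANT lane typer seat prim-quant-stmt (gen 28), rung R8 of
`run/shared/lean/prim/quant/LADDER.md`.  Theorems only, standard axioms, no sorries, no definitions.  Parts 1–4: `…QuantLowToZeroMove`,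
`…QuantGateMoveBlobDatum`, `…QuantGateMoveBlobCorner`, `…QuantLowToZeroMoveMid`; part 5a `…QuantLowToZeroRouting` (the routing).  Finishing criterion: arm-1 g39's income criterion
`LawDec.flowAtT_of_income` (`…QuantIncomeCriterion`).

* **`LawDec.flowAtT_lowToZero_of_income`** — `L` an arbitrary law with a flow datum `f` at `(y, τ, j)` on `{0..N}`, `a` a `t`-low
  (`a ≤ j`, `2a < t ≤ τ`) shipping at most `ε ≤ L a` to the giants, the moved law `P = L + ε(δ₀ − δ_a)` a probability law of mean `t`
  with `y·N ≤ t`.  Routing of the nonzero `t`-lows of `P`: mid pairs of `f` kept (those of `a` scaled to its new mass), the giant-bound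
  mass `λ_ℓ = Σ_{h>j} f ℓ h` of every nonzero `t`-low `ℓ ≠ a` spread over the giants proportionally to their masses.  If
  `Σ_{ℓ ≠ 0, a} ℓ·λ_ℓ ≤ Σ_{t-mids h < t} (t − h)·P h + Σ_{giants} P h·(t − y h)/y` (low-mid income + giant slack), then
  `P ∈ FlowAtT(y, t, j)`.  With all `λ_ℓ = 0` this is part 1's `flowAtT_lowToZero_of_midAbsorbed`; the pair slacks and the below-`t`
  flow income of `flowAtT_of_income` are given away (memo GATE-MOVE-G28 §6: the residual (b′)/(R1) of (M) is exactly an instance of the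
  aggregated inequality — "GS + twins").
HONEST STATUS: (M) ∀ a, `GateMove`, `GatedConvEmptyFree`, `SingleGateConvClosed`, `SDECConvClosed`, `TreeDEC`, `FarTreeRow` remain OPEN.

[this work]; income criterion arm-1 g39, (M) typer g27 (this lane).  The gluing rows served [cite: KozmaNitzan2024, Conjecture 3 (p. 15)];
product measure [cite: Grimmett1999, §1.3 p. 10].
-/

noncomputable section

namespace Summit.CriticalPhenomena.PercolationContinuityZ3.Theorems

namespace Quant

open Finset

namespace LawDec

/-- **THE LOW-TO-ZERO MOVE IN INCOME FORM.**  See the module docstring. [this work] -/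
theorem flowAtT_lowToZero_of_income (y τ t ε : ℝ) (a j N : ℕ) (L : ℕ → ℝ) (f : ℕ → ℕ → ℝ)
    (hy0 : 0 < y) (hy1 : y < 1) (htτ : t ≤ τ) (haj : a ≤ j) (hat : 2 * (a : ℝ) < t) (hjN : j < N)
    (hL0 : ∀ h, 0 ≤ L h) (hf : IsFlowAtT y τ j N L f) (hεa : ε ≤ L a)
    (hP0 : ∀ h, 0 ≤ L h + ε * ((if h = 0 then (1 : ℝ) else 0) - (if h = a then (1 : ℝ) else 0)))
    (hP1 : ∑ h ∈ Finset.range (N + 1), (L h + ε * ((if h = 0 then (1 : ℝ) else 0) - (if h = a then (1 : ℝ) else 0))) = 1)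
    (hPt : ∑ h ∈ Finset.range (N + 1),
      (h : ℝ) * (L h + ε * ((if h = 0 then (1 : ℝ) else 0) - (if h = a then (1 : ℝ) else 0))) = t)
    (hta : y * (N : ℝ) ≤ t)
    (hGa : ∑ h ∈ Finset.Ico (j + 1) (N + 1), f a h ≤ ε)
    (hinc : ∑ l ∈ Finset.range (j + 1),
        (if (1 ≤ l ∧ 2 * (l : ℝ) < t ∧ l ≠ a) then (l : ℝ) * ∑ h ∈ Finset.Ico (j + 1) (N + 1), f l h else 0)
      ≤ ∑ h ∈ Finset.range (j + 1), (if (t ≤ 2 * (h : ℝ) ∧ (h : ℝ) < t) then (t - (h : ℝ)) * L h else 0)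
        + ∑ h ∈ Finset.Ico (j + 1) (N + 1), L h * (t - y * (h : ℝ)) / y) :
    FlowAtT y t j N (fun h => L h + ε * ((if h = 0 then (1 : ℝ) else 0) - (if h = a then (1 : ℝ) else 0))) := by
  classical
  obtain ⟨φ, hφ0, hφsupp, hφrow, hφcol, hrow_mid, hcostM, hcostG⟩ :=
    lowToZero_routing y τ t ε a j N L f hy0 hy1 htτ haj hat hjN hL0 hf hεa hta hGa
  obtain ⟨hf0, hfsupp, hfrow, hfcap⟩ := hf
  set P : ℕ → ℝ := fun h => L h + ε * ((if h = 0 then (1 : ℝ) else 0) - (if h = a then (1 : ℝ) else 0)) with hP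
  have ht0 : 0 < t := by linarith [(Nat.cast_nonneg a : (0 : ℝ) ≤ a)]
  have hjN1 : j + 1 ≤ N + 1 := by omega
  have hPoff : ∀ h, h ≠ 0 → h ≠ a → P h = L h := fun h h0 ha => by
    simp only [hP, if_neg h0, if_neg ha, sub_self, mul_zero, add_zero]
  have hPa : 1 ≤ a → P a = L a - ε := fun ha1 => by
    simp only [hP, if_neg (show a ≠ 0 by omega), if_true]; ring
  have hPgiant : ∀ h, j + 1 ≤ h → P h = L h := fun h hh => hPoff h (by omega) (by omega)
  have htaN : ∀ h : ℕ, h ≤ j → h ≤ N → t < (h : ℝ) → y * (h : ℝ) ≤ t := fun h _ hhN _ =>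
    le_trans (mul_le_mul_of_nonneg_left (by exact_mod_cast hhN) hy0.le) hta
  have hmom : t * ∑ h ∈ Finset.range (N + 1), P h ≤ ∑ h ∈ Finset.range (N + 1), (h : ℝ) * P h := by
    rw [hP1, mul_one]; exact le_of_eq hPt.symm
  -- INCOME split
  have hincome : ∑ h ∈ Finset.range (N + 1),
      (if j + 1 ≤ h then (t - y * (h : ℝ)) / y else if (1 ≤ h ∧ (h : ℝ) < t) then t - (h : ℝ) else 0) * P h
      = ∑ h ∈ Finset.range (j + 1), (if (1 ≤ h ∧ (h : ℝ) < t) then (t - (h : ℝ)) * P h else 0)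
        + ∑ h ∈ Finset.Ico (j + 1) (N + 1), L h * (t - y * (h : ℝ)) / y := by
    rw [← Finset.sum_range_add_sum_Ico _ hjN1]
    congr 1
    · refine Finset.sum_congr rfl fun h hh => ?_
      have hhj : h ≤ j := Nat.lt_succ_iff.1 (Finset.mem_range.1 hh)
      rw [if_neg (show ¬ (j + 1 ≤ h) by omega)]
      split_ifs <;> ring
    · refine Finset.sum_congr rfl fun h hh => ?_
      obtain ⟨hh1, _⟩ := Finset.mem_Ico.1 hh
      rw [if_pos hh1, hPgiant h hh1]
      ring
  -- the income of the lows and low mids below `t`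
  have hinc_split : ∑ h ∈ Finset.range (j + 1), (if (1 ≤ h ∧ (h : ℝ) < t) then (t - (h : ℝ)) * P h else 0)
      = ∑ h ∈ Finset.range (j + 1), (if (1 ≤ h ∧ 2 * (h : ℝ) < t) then (t - (h : ℝ)) * P h else 0)
        + ∑ h ∈ Finset.range (j + 1), (if (t ≤ 2 * (h : ℝ) ∧ (h : ℝ) < t) then (t - (h : ℝ)) * L h else 0) := by
    rw [← Finset.sum_add_distrib]
    refine Finset.sum_congr rfl fun h hh => ?_
    by_cases h1 : 1 ≤ h ∧ (h : ℝ) < t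
    · rw [if_pos h1]
      by_cases h2 : 2 * (h : ℝ) < t
      · rw [if_pos ⟨h1.1, h2⟩, if_neg (fun h' => by linarith [h'.1]), add_zero]
      · rw [if_neg (fun h' => h2 h'.2), if_pos ⟨not_lt.1 h2, h1.2⟩, zero_add, hPoff h (by omega) (by rintro rfl; exact h2 hat)]
    · rw [if_neg h1]
      by_cases h2 : 1 ≤ h ∧ 2 * (h : ℝ) < t
      · exact absurd ⟨h2.1, by linarith [h2.2, (Nat.cast_nonneg h : (0:ℝ) ≤ h)]⟩ h1
      · rw [if_neg h2]
        by_cases h3 : t ≤ 2 * (h : ℝ) ∧ (h : ℝ) < t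
        · exfalso
          have : 1 ≤ h := by
            by_contra h0
            have : h = 0 := by omega
            subst this; push_cast at h3; linarith [h3.1]
          exact h1 ⟨this, h3.2⟩
        · rw [if_neg h3, add_zero]
  -- the cost bound in terms of the rows
  have hrows_val : ∑ l ∈ Finset.range (j + 1),
      (if (1 ≤ l ∧ 2 * (l : ℝ) < t) then (t - (l : ℝ)) * ∑ m ∈ Finset.range (j + 1), φ l m else 0)
      + t * ∑ l ∈ Finset.range (j + 1),
          (if (1 ≤ l ∧ 2 * (l : ℝ) < t ∧ l ≠ a) then ∑ h ∈ Finset.Ico (j + 1) (N + 1), f l h else 0)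
      = ∑ l ∈ Finset.range (j + 1), (if (1 ≤ l ∧ 2 * (l : ℝ) < t) then (t - (l : ℝ)) * P l else 0)
        + ∑ l ∈ Finset.range (j + 1),
          (if (1 ≤ l ∧ 2 * (l : ℝ) < t ∧ l ≠ a) then (l : ℝ) * ∑ h ∈ Finset.Ico (j + 1) (N + 1), f l h else 0) := by
    rw [Finset.mul_sum, ← Finset.sum_add_distrib, ← Finset.sum_add_distrib]
    refine Finset.sum_congr rfl fun l hl => ?_
    have hlj : l ≤ j := Nat.lt_succ_iff.1 (Finset.mem_range.1 hl)
    by_cases hc : 1 ≤ l ∧ 2 * (l : ℝ) < t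
    · rw [if_pos hc, if_pos hc, hrow_mid l hc.1 hlj hc.2]
      by_cases hla : l = a
      · have h3 : ¬ (1 ≤ l ∧ 2 * (l : ℝ) < t ∧ l ≠ a) := fun h' => h'.2.2 hla
        rw [if_pos hla, if_neg h3, if_neg h3, hla, hPa (by omega)]
        ring
      · have h3 : (1 ≤ l ∧ 2 * (l : ℝ) < t ∧ l ≠ a) := ⟨hc.1, hc.2, hla⟩
        rw [if_neg hla, if_pos h3, if_pos h3, hPoff l (by omega) hla, ← hfrow l hlj (by linarith [hc.2]),
          ← Finset.sum_range_add_sum_Ico _ hjN1]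
        ring
    · have h3 : ¬ (1 ≤ l ∧ 2 * (l : ℝ) < t ∧ l ≠ a) := fun h' => hc ⟨h'.1, h'.2.1⟩
      simp only [if_neg hc, if_neg h3]
      ring
  -- abbreviate the big sums and conclude the income inequality
  set CM : ℝ := ∑ h ∈ Finset.range (j + 1),
      (if j + 1 ≤ h then t * (1 - y) / y else if t < (h : ℝ) then (h : ℝ) - t else 0)
        * ∑ l ∈ Finset.range (j + 1), usage y t j l h * φ l h with hCM
  set RW : ℝ := ∑ l ∈ Finset.range (j + 1),
      (if (1 ≤ l ∧ 2 * (l : ℝ) < t) then (t - (l : ℝ)) * ∑ m ∈ Finset.range (j + 1), φ l m else 0) with hRW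
  set LOWINC : ℝ := ∑ l ∈ Finset.range (j + 1), (if (1 ≤ l ∧ 2 * (l : ℝ) < t) then (t - (l : ℝ)) * P l else 0)
    with hLOWINC
  set LMI : ℝ := ∑ h ∈ Finset.range (j + 1), (if (t ≤ 2 * (h : ℝ) ∧ (h : ℝ) < t) then (t - (h : ℝ)) * L h else 0)
    with hLMI
  set GSUM : ℝ := ∑ h ∈ Finset.Ico (j + 1) (N + 1), L h * (t - y * (h : ℝ)) / y with hGSUM
  set LLAM : ℝ := ∑ l ∈ Finset.range (j + 1),
      (if (1 ≤ l ∧ 2 * (l : ℝ) < t ∧ l ≠ a) then (l : ℝ) * ∑ h ∈ Finset.Ico (j + 1) (N + 1), f l h else 0)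
    with hLLAM
  have hlowinc : 0 ≤ LOWINC :=
    Finset.sum_nonneg fun h _ => by
      split_ifs with hc
      · exact mul_nonneg (by linarith [hc.2, (Nat.cast_nonneg h : (0:ℝ) ≤ h)]) (hP0 h)
      · exact le_rfl
  have hincF : ∑ h ∈ Finset.range (N + 1),
        (if j + 1 ≤ h then t * (1 - y) / y else if t < (h : ℝ) then (h : ℝ) - t else 0)
          * ∑ l ∈ Finset.range (j + 1), usage y t j l h * φ l h
      ≤ ∑ h ∈ Finset.range (N + 1),
        (if j + 1 ≤ h then (t - y * (h : ℝ)) / y else if (1 ≤ h ∧ (h : ℝ) < t) then t - (h : ℝ) else 0) * P h := by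
    rw [← Finset.sum_range_add_sum_Ico _ hjN1, hincome, hinc_split, ← hCM]
    linarith [hcostM, hcostG, hrows_val, hinc, hlowinc]
  exact flowAtT_of_income y t j N P φ hy0 hy1 ht0 hP0 htaN hφ0 hφsupp hφrow hφcol hmom hincF

end LawDec

end Quant

end Summit.CriticalPhenomena.PercolationContinuityZ3.Theorems
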